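import Literature.Analysis.FluidPDE.TimeDependentLinearFlow
import Literature.Analysis.FluidPDE.SuitableWeak
import Literature.Analysis.FluidPDE.NSWave0
import Literature.Analysis.FluidPDE.AxisymmetricEuler
import Summits.NavierStokesRegularity.FluidComputer.AngularGalerkinLadderBasics
import Summits.NavierStokesRegularity.FluidComputer.AngularGalerkinLadderLinearFlows
import HarnessLib

/-!
# KJ-20 — the sup-norm Type-I clause is the ONLY junk guard of a centred forward rung stub:
# Craik–Criminale linear strain flows inhabit every other clause (route `AngularGalerkinLadder`, K1)

Negative-lane helper for `stmt-NavierStokesRegularity-19959` (`RungBlowupCofinal`, crux K1 of route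
№8 `AngularGalerkinLadder`), cell ns-blowup, refuter g14 (KJ-20).  Companion of
`Theorems/RungBlowupCofinal/Negative/ForwardStubParasitic.lean` (KJ-18: the Galilean drift
`−log(1−t) e₀` inhabits the registered forward stub `Birth.RungForwardTypeIBlowup L`, `L ≥ 1`).

The bc5-witness line (HOME `ns-agl-bc5w-19959/HalfTurn_line_v1.lean`) answers KJ-18 by putting the
forward blow-up in the **half-turn cell** (slices odd and `rotZ π`-equivariant — this kills every
constant drift, `c` odd `⇒ c = 0`) and by adding a **centre-gradient floor**
`∃ κ > 0, ∃ᶠ t → T⁻, κ ≤ (T − t)‖∇u(t)(0)‖` and a **triaxial germ**.  This file records, as kernel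
theorems and WITHOUT importing any route file, what then carries the physics:

* `isRungSolutionOn_linearStrain` — for every symmetric trace-free `D : ℝ³ →L ℝ³`, every smooth
  amplitude `a` on a time set `s` of unique differentiability, every viscosity `ν` and every `L ≥ 2`,
  the Craik–Criminale linear flow `u(t, x) = a(t) D x` with the quadratic pressure
  `−½⟪x, (ȧ D + a² D²) x⟫` and defect `d = 0` is a rung-`L` solution (`IsRungSolutionOn s ν L`):
  an exact Navier–Stokes solution (`LinearFlow.isClassicalNSSolutionOn`, Drazin Ex. 2.19), each
  slice a linear field hence band-limited of degree `≤ 2` (`isBandLimited_two_clm`), zero defect.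
* `halfTurnClauses_without_typeI_parasitic` — with `D = diag(1, 2, −3)` and `a(t) = t/(1 − t)` on
  `[0, 1)`: zero (Schwartz) datum, every slice odd AND `rotZ π`-equivariant (the half-turn cell),
  centre gradient `∇u(t)(0) = a(t) D` with the coordinate axes as eigenvectors and the three distinct
  eigenvalues `a(t)·(1, 2, −3)` (triaxial for `t > 0`), centre-gradient floor
  `(1 − t)‖∇u(t)(0)‖ ≥ 3t` (so `κ = 3/2` frequently — indeed eventually — as `t → 1⁻`), unbounded on
  `[0, 1) × ℝ³`, and **NOT** a sup-norm Type-I blow-up (`¬ IsTypeIBlowup u 1`: every slice `t > 0` is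
  unbounded in `x`).

* §3 (why the centred KNSS clause is the natural repair): `knss_rescale` — the bound
  `‖u t x‖ ≤ C/(‖x‖ + √(T − t))` on `[0, T)` is inherited by EVERY blow-up rescaling
  `λ u(T + λ²s, λy)` with the SAME constant, as `C/(‖y‖ + √(−s))`; `hasTypeIDecay_of_tendsto` — and it
  is closed under pointwise limits, so a tangent flow extracted under it carries `HasTypeIDecay C` for
  free; `typeI_rescale` — the sup-norm clause rescales only to the time decay `C/√(−s)`.

READING (refuter, not a verdict on any item).  In a forward rung stub of the shape
`IsRungSolutionOn ∧ smooth decaying datum ∧ (cell symmetry) ∧ IsTypeIBlowup u T ∧ (centre floor) ∧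
(triaxial germ)`, the sup-norm clause `IsTypeIBlowup u T` — the one clause that says nothing about the
centre — is the SOLE clause excluding this energy-free family; any later weakening of it to a
local/centred form re-admits the family verbatim.  Conversely the clause that would kill BOTH junk
families (drifts and strains) and at the same time feed the extraction stub the spatial decay
`HasTypeIDecay` of the tangent flow for free is the centred KNSS form
`∃ C, ∀ t ∈ [0,T), ∀ x, ‖u t x‖ ≤ C / (‖x‖ + √(T − t))` (scaling: `λ u(T + λ²s, λy)` then obeys
`C/(‖y‖ + √(−s))`), or finite energy `∀ t, MemLp (u t) 2`.  Infinite-energy exact solutions: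
Craik–Criminale 1986 §2; Drazin 2002 Ex. 2.19; Majda–Bertozzi 2002 §1.3.
-/

open Set Function Filter
open scoped Topology RealInnerProductSpace ContDiff

namespace Summit.NavierStokesRegularity.RungBlowupCofinalLinearStrainParasitic

open Literature.Analysis.FluidPDE
open Summit.NavierStokesRegularity.FluidComputer
open Summit.NavierStokesRegularity.FluidComputer.AngularLadder

/-! ## §1 Linear strain flows are rung solutions at every level `L ≥ 2` -/

/-- **Craik–Criminale strain flows are rung-`L` solutions, `L ≥ 2`, with zero defect.**  For a
symmetric trace-free `D`, a smooth amplitude `a` on `s` (unique differentiability), any `ν`: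
`u(t,x) = a(t) D x`, `p(t,x) = −½⟪x, (ȧ(t) D + a(t)² D²) x⟫`, `d = 0` satisfy
`IsRungSolutionOn s ν L u p d` — exact NS (viscous term vanishes), linear slices are band-limited of
degree `≤ 2`, the zero force is co-band-limited. Infinite energy. [cite: Drazin2002, Ex. 2.19] -/
theorem isRungSolutionOn_linearStrain
    (D : EuclideanSpace ℝ (Fin 3) →L[ℝ] EuclideanSpace ℝ (Fin 3))
    (hDs : ∀ x y, ⟪D x, y⟫ = ⟪x, D y⟫)
    (hDtr : LinearMap.trace ℝ _ (D : EuclideanSpace ℝ (Fin 3) →ₗ[ℝ] EuclideanSpace ℝ (Fin 3)) = 0)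
    {s : Set ℝ} (hs : UniqueDiffOn ℝ s) {a : ℝ → ℝ} (ha : ContDiffOn ℝ ∞ a s) (ν : ℝ) {L : ℕ}
    (hL : 2 ≤ L) :
    IsRungSolutionOn s ν L (LinearFlow.velocity (fun t => a t • D) 0)
      (LinearFlow.pressure (fun t => a t • D) (fun t => derivWithin a s t • D) 0 0 0)
      (fun _ _ => 0) := by
  have ha' : ContDiffOn ℝ ∞ (derivWithin a s) s := ((contDiffOn_infty_iff_derivWithin hs).1 ha).2
  refine ⟨?_, fun t _ => ?_, fun t _ => ?_⟩
  · have h := LinearFlow.isClassicalNSSolutionOn (fun t => a t • D) (fun t => derivWithin a s t • D)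
      0 0 0 hs ν (ha.smul contDiffOn_const) (ha'.smul contDiffOn_const) contDiffOn_const
      contDiffOn_const contDiffOn_const
      (fun t ht => ((ha.differentiableOn (by simp)) t ht).hasDerivWithinAt.smul_const D)
      (fun t _ => hasDerivWithinAt_const t s _)
      (fun t _ => by
        show LinearMap.trace ℝ _ ((a t • D : EuclideanSpace ℝ (Fin 3) →L[ℝ] _) :
          EuclideanSpace ℝ (Fin 3) →ₗ[ℝ] EuclideanSpace ℝ (Fin 3)) = 0
        rw [show ((a t • D : EuclideanSpace ℝ (Fin 3) →L[ℝ] EuclideanSpace ℝ (Fin 3)) :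
            EuclideanSpace ℝ (Fin 3) →ₗ[ℝ] EuclideanSpace ℝ (Fin 3))
            = a t • (D : EuclideanSpace ℝ (Fin 3) →ₗ[ℝ] EuclideanSpace ℝ (Fin 3)) from rfl,
          map_smul, hDtr, smul_zero])
      (fun t _ x y => by
        simp only [LinearFlow.ccMatrix_apply, FunLike.coe_smul, Pi.smul_apply,
          map_smul, inner_add_left, inner_add_right, real_inner_smul_left, real_inner_smul_right,
          hDs])
    exact h
  · have hv : LinearFlow.velocity (fun t => a t • D) 0 t = ⇑(a t • D) := by
      funext x; simp [LinearFlow.velocity]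
    rw [hv]
    exact (isBandLimited_two_clm (a t • D)).mono hL
  · exact isCobandLimited_zero_field L

/-! ## §2 The triaxial strain blow-up `u(t, x) = t/(1−t) · diag(1, 2, −3) x` -/

/-- The zero datum decays rapidly. [folklore] -/
theorem hasRapidSpatialDecay_zero :
    HasRapidSpatialDecay (fun _ : EuclideanSpace ℝ (Fin 3) => (0 : EuclideanSpace ℝ (Fin 3))) := by
  intro n K
  refine ⟨0, fun x => ?_⟩
  have h0 : (fun _ : EuclideanSpace ℝ (Fin 3) => (0 : EuclideanSpace ℝ (Fin 3))) = 0 := rfl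
  rw [h0, iteratedFDeriv_zero]
  simp

/-- The amplitude `t/(1 − t)` is smooth on `[0, 1)`. [folklore] -/
theorem contDiffOn_amp : ContDiffOn ℝ ∞ (fun t : ℝ => t / (1 - t)) (Ico 0 1) :=
  contDiffOn_id.div (contDiffOn_const.sub contDiffOn_id) fun t ht => by
    have := ht.2; exact sub_ne_zero.2 (ne_of_gt this)

/-- **Every clause of a centred half-turn forward rung stub EXCEPT the sup-norm Type-I clause is
inhabited by an energy-free exact linear strain flow** (`L ≥ 2`, any `ν`): rung-`L` solution on
`[0, 1)` with zero defect, zero datum (smooth, rapidly decaying), every slice odd and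
`rotZ π`-equivariant, centre gradient with eigenvectors `e_i` and eigenvalues `t/(1−t)·(1, 2, −3)`,
centre-gradient floor `3t ≤ (1 − t)‖∇u(t)(0)‖` (hence the `∃ κ > 0, ∃ᶠ t → 1⁻` letter with `κ = 3/2`),
unbounded, and NOT `IsTypeIBlowup u 1`. [cite: Drazin2002, Ex. 2.19] -/
theorem halfTurnClauses_without_typeI_parasitic (ν : ℝ) {L : ℕ} (hL : 2 ≤ L) :
    ∃ (u : ℝ → EuclideanSpace ℝ (Fin 3) → EuclideanSpace ℝ (Fin 3))
      (p : ℝ → EuclideanSpace ℝ (Fin 3) → ℝ)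
      (d : ℝ → EuclideanSpace ℝ (Fin 3) → EuclideanSpace ℝ (Fin 3)),
      IsRungSolutionOn (Ico 0 1) ν L u p d ∧
      u 0 = (fun _ => 0) ∧ ContDiff ℝ (⊤ : ℕ∞) (u 0) ∧ HasRapidSpatialDecay (u 0) ∧
      (∀ t x, u t (-x) = -u t x) ∧
      (∀ t x, u t (rotZ Real.pi x) = rotZ Real.pi (u t x)) ∧
      (∀ t (i : Fin 3), fderiv ℝ (u t) 0 (EuclideanSpace.single i 1) =
        (t / (1 - t) * (![1, 2, -3] : Fin 3 → ℝ) i) • EuclideanSpace.single i 1) ∧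
      (∀ t ∈ Ico (0 : ℝ) 1, 3 * t ≤ (1 - t) * ‖fderiv ℝ (u t) 0‖) ∧
      (∃ κ : ℝ, 0 < κ ∧ ∃ᶠ t in 𝓝[<] (1 : ℝ), κ ≤ (1 - t) * ‖fderiv ℝ (u t) 0‖) ∧
      ¬ IsTypeIBlowup u 1 ∧
      ¬ ∃ M : ℝ, ∀ t ∈ Ico (0 : ℝ) 1, ∀ x, ‖u t x‖ ≤ M := by
  -- the strain matrix `D = diag(1, 2, -3)` as a continuous linear map, by its action
  obtain ⟨D, hD⟩ : ∃ D : EuclideanSpace ℝ (Fin 3) →L[ℝ] EuclideanSpace ℝ (Fin 3),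
      ∀ x, D x = WithLp.toLp 2 ![x 0, 2 * x 1, -3 * x 2] :=
    ⟨LinearMap.toContinuousLinearMap
      { toFun := fun x => WithLp.toLp 2 ![x 0, 2 * x 1, -3 * x 2]
        map_add' := fun v w => by ext i; fin_cases i <;> (simp; try ring)
        map_smul' := fun c v => by ext i; fin_cases i <;> (simp; try ring) }, fun x => rfl⟩
  have hDi : ∀ x (i : Fin 3), D x i = (![1, 2, -3] : Fin 3 → ℝ) i * x i := by
    intro x i; rw [hD]; fin_cases i <;> simp
  have hsingle : ∀ i j : Fin 3,
      (EuclideanSpace.single i (1 : ℝ) : EuclideanSpace ℝ (Fin 3)) j = if j = i then 1 else 0 :=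
    fun i j => by simp
  have hn1 : ‖(EuclideanSpace.single 2 (1 : ℝ) : EuclideanSpace ℝ (Fin 3))‖ = 1 := by simp
  -- symmetric, trace-free
  have hDs : ∀ x y, ⟪D x, y⟫ = ⟪x, D y⟫ := by
    intro x y
    simp only [PiLp.inner_apply, Fin.sum_univ_three, hDi, RCLike.inner_apply, conj_trivial]
    simp; ring
  have hDtr : LinearMap.trace ℝ _
      (D : EuclideanSpace ℝ (Fin 3) →ₗ[ℝ] EuclideanSpace ℝ (Fin 3)) = 0 := by
    rw [LinearMap.trace_eq_sum_inner _ (EuclideanSpace.basisFun (Fin 3) ℝ)]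
    simp only [Fin.sum_univ_three, EuclideanSpace.basisFun_apply, ContinuousLinearMap.coe_coe,
      EuclideanSpace.inner_single_left, hDi, hsingle]
    simp; norm_num
  -- the single vector `e₂` is an eigenvector with eigenvalue `-3`, so `‖D‖ ≥ 3`
  have hDe : D (EuclideanSpace.single 2 1) = (-3 : ℝ) • EuclideanSpace.single 2 1 := by
    ext i; rw [hDi]; fin_cases i <;> simp
  have hDnorm : 3 ≤ ‖D‖ := by
    have h := D.le_opNorm (EuclideanSpace.single 2 (1 : ℝ))
    rw [hDe, norm_smul, hn1] at h
    simpa using h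
  -- the flow
  set a : ℝ → ℝ := fun t => t / (1 - t) with ha_def
  refine ⟨LinearFlow.velocity (fun t => a t • D) 0,
    LinearFlow.pressure (fun t => a t • D) (fun t => derivWithin a (Ico 0 1) t • D) 0 0 0,
    fun _ _ => 0, isRungSolutionOn_linearStrain D hDs hDtr (uniqueDiffOn_Ico 0 1) contDiffOn_amp ν hL,
    ?_, ?_, ?_, ?_, ?_, ?_, ?_, ?_, ?_, ?_⟩
  · funext x; simp [LinearFlow.velocity, a]
  · have h0 : LinearFlow.velocity (fun t => a t • D) 0 0 = fun _ => 0 := by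
      funext x; simp [LinearFlow.velocity, a]
    rw [h0]; exact contDiff_const
  · have h0 : LinearFlow.velocity (fun t => a t • D) 0 0 = fun _ => 0 := by
      funext x; simp [LinearFlow.velocity, a]
    rw [h0]; exact hasRapidSpatialDecay_zero
  · intro t x; simp [LinearFlow.velocity]
  · intro t x
    ext i
    simp only [LinearFlow.velocity_apply, Pi.zero_apply, add_zero, FunLike.coe_smul,
      Pi.smul_apply, PiLp.smul_apply, smul_eq_mul]
    fin_cases i
    · simp [hDi, rotZ, Real.cos_pi, Real.sin_pi]
    · simp [hDi, rotZ, Real.cos_pi, Real.sin_pi]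
    · simp [hDi, rotZ, Real.cos_pi, Real.sin_pi]
  · intro t i
    rw [LinearFlow.fderiv_velocity]
    ext j
    simp only [FunLike.coe_smul, Pi.smul_apply, PiLp.smul_apply, smul_eq_mul, hDi,
      hsingle]
    by_cases h : j = i
    · subst h; rw [if_pos rfl]; simp only [ha_def]; ring
    · rw [if_neg h]; ring
  · intro t ht
    rw [LinearFlow.fderiv_velocity]
    show 3 * t ≤ (1 - t) * ‖a t • D‖
    have h1t : 0 < 1 - t := by linarith [ht.2]
    have hat : 0 ≤ a t := by simp only [a]; exact div_nonneg ht.1 h1t.le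
    rw [norm_smul, Real.norm_eq_abs, abs_of_nonneg hat]
    have : (1 - t) * (a t * ‖D‖) = t * ‖D‖ := by
      simp only [a]; field_simp
    rw [this]
    nlinarith [ht.1, hDnorm]
  · refine ⟨3 / 2, by norm_num, ?_⟩
    have hev : ∀ᶠ t in 𝓝[<] (1 : ℝ), (3 : ℝ) / 2 ≤ (1 - t) * ‖fderiv ℝ
        (LinearFlow.velocity (fun t => a t • D) 0 t) 0‖ := by
      filter_upwards [Ioo_mem_nhdsLT (show (1 : ℝ) / 2 < 1 by norm_num)] with t ht
      rw [LinearFlow.fderiv_velocity]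
      show (3 : ℝ) / 2 ≤ (1 - t) * ‖a t • D‖
      have h1t : 0 < 1 - t := by linarith [ht.2]
      have hat : 0 ≤ a t := by simp only [a]; exact div_nonneg (by linarith [ht.1]) h1t.le
      rw [norm_smul, Real.norm_eq_abs, abs_of_nonneg hat]
      have : (1 - t) * (a t * ‖D‖) = t * ‖D‖ := by
        simp only [a]; field_simp
      rw [this]
      nlinarith [ht.1, hDnorm]
    exact hev.frequently
  · -- not a sup-norm Type-I blow-up: every slice `t ∈ (1/2, 1)` is unbounded in `x`
    rintro ⟨C, hC⟩
    obtain ⟨t, hb, ht⟩ := (hC.and (Ioo_mem_nhdsLT (show (1 : ℝ) / 2 < 1 by norm_num))).exists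
    have h1t : 0 < 1 - t := by linarith [ht.2]
    have hat : 1 ≤ a t := by
      simp only [a]; rw [le_div_iff₀ h1t]; linarith [ht.1]
    set M : ℝ := max 0 (C / Real.sqrt (1 - t)) + 1 with hM_def
    have hM0 : 0 ≤ M := by have := le_max_left 0 (C / Real.sqrt (1 - t)); linarith
    have hMC : C / Real.sqrt (1 - t) < M := by
      have := le_max_right 0 (C / Real.sqrt (1 - t)); linarith
    have hval : ‖LinearFlow.velocity (fun t => a t • D) 0 t (M • EuclideanSpace.single 2 1)‖
        = a t * (M * 3) := by
      simp only [LinearFlow.velocity_apply, Pi.zero_apply, add_zero, FunLike.coe_smul,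
        Pi.smul_apply, map_smul, hDe, smul_smul, norm_smul, hn1, Real.norm_eq_abs]
      rw [mul_one, show M * (a t * -3) = -(M * a t * 3) by ring, abs_neg,
        abs_of_nonneg (mul_nonneg (mul_nonneg hM0 (by linarith)) (by norm_num))]
      ring
    have hx := hb (M • EuclideanSpace.single 2 1)
    rw [hval] at hx
    nlinarith [hM0, hat, hMC, hx]
  · rintro ⟨M, hM⟩
    have ht : (1 : ℝ) / 2 ∈ Ico (0 : ℝ) 1 := ⟨by norm_num, by norm_num⟩
    have hat : a (1 / 2) = 1 := by simp only [a]; norm_num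
    set N : ℝ := max 0 M + 1 with hN_def
    have hN0 : 0 ≤ N := by have := le_max_left 0 M; linarith
    have hNM : M < N := by have := le_max_right 0 M; linarith
    have hval : ‖LinearFlow.velocity (fun t => a t • D) 0 (1 / 2) (N • EuclideanSpace.single 2 1)‖
        = N * 3 := by
      simp only [LinearFlow.velocity_apply, Pi.zero_apply, add_zero, FunLike.coe_smul,
        Pi.smul_apply, map_smul, hDe, smul_smul, norm_smul, hn1, Real.norm_eq_abs, hat]
      rw [mul_one, show N * (1 * -3) = -(N * 3) by ring, abs_neg,
        abs_of_nonneg (by linarith)]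
    have hx := hM (1 / 2) ht (N • EuclideanSpace.single 2 1)
    rw [hval] at hx
    nlinarith [hN0, hNM, hx]

/-! ## §3 The centred KNSS clause rescales with the same constant and passes to pointwise limits -/

/-- **Blow-up rescalings inherit the centred KNSS bound with the SAME constant.**  If
`‖u t x‖ ≤ C/(‖x‖ + √(T − t))` on `[0, T) × ℝ³` and `λ > 0`, then the rescaled field
`u_λ(s, y) = λ u(T + λ² s, λ y)` satisfies `‖u_λ s y‖ ≤ C/(‖y‖ + √(−s))` whenever `T + λ² s ∈ [0, T)`
(scale invariance of the KNSS weight, KNSS 2009 (1.6)). [folklore] -/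
theorem knss_rescale {u : ℝ → EuclideanSpace ℝ (Fin 3) → EuclideanSpace ℝ (Fin 3)} {T C lam : ℝ}
    (hlam : 0 < lam) (h : ∀ t ∈ Ico (0 : ℝ) T, ∀ x, ‖u t x‖ ≤ C / (‖x‖ + Real.sqrt (T - t)))
    {s : ℝ} (hs : T + lam ^ 2 * s ∈ Ico (0 : ℝ) T) (y : EuclideanSpace ℝ (Fin 3)) :
    ‖lam • u (T + lam ^ 2 * s) (lam • y)‖ ≤ C / (‖y‖ + Real.sqrt (-s)) := by
  have hl2 : 0 < lam ^ 2 := by positivity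
  have hs0 : 0 < -s := by
    have h2 := hs.2
    nlinarith
  have hb := h _ hs (lam • y)
  have hden : ‖lam • y‖ + Real.sqrt (T - (T + lam ^ 2 * s)) = lam * (‖y‖ + Real.sqrt (-s)) := by
    rw [norm_smul, Real.norm_eq_abs, abs_of_pos hlam,
      show T - (T + lam ^ 2 * s) = lam ^ 2 * (-s) by ring, Real.sqrt_mul' _ hs0.le,
      Real.sqrt_sq hlam.le]
    ring
  rw [hden] at hb
  have hpos : 0 < ‖y‖ + Real.sqrt (-s) := by
    have := Real.sqrt_pos.2 hs0
    linarith [norm_nonneg y]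
  rw [norm_smul, Real.norm_eq_abs, abs_of_pos hlam]
  calc lam * ‖u (T + lam ^ 2 * s) (lam • y)‖
      ≤ lam * (C / (lam * (‖y‖ + Real.sqrt (-s)))) := mul_le_mul_of_nonneg_left hb hlam.le
    _ = C / (‖y‖ + Real.sqrt (-s)) := by field_simp

/-- **The sup-norm Type-I clause rescales only to TIME decay** `C/√(−s)` (same constant, no spatial
weight): nothing about `‖y‖` is gained. [folklore] -/
theorem typeI_rescale {u : ℝ → EuclideanSpace ℝ (Fin 3) → EuclideanSpace ℝ (Fin 3)} {T C lam : ℝ}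
    (hlam : 0 < lam) (h : ∀ t ∈ Ico (0 : ℝ) T, ∀ x, ‖u t x‖ ≤ C / Real.sqrt (T - t))
    {s : ℝ} (hs : T + lam ^ 2 * s ∈ Ico (0 : ℝ) T) (y : EuclideanSpace ℝ (Fin 3)) :
    ‖lam • u (T + lam ^ 2 * s) (lam • y)‖ ≤ C / Real.sqrt (-s) := by
  have hl2 : 0 < lam ^ 2 := by positivity
  have hs0 : 0 < -s := by
    have h2 := hs.2
    nlinarith
  have hb := h _ hs (lam • y)
  have hden : Real.sqrt (T - (T + lam ^ 2 * s)) = lam * Real.sqrt (-s) := by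
    rw [show T - (T + lam ^ 2 * s) = lam ^ 2 * (-s) by ring, Real.sqrt_mul' _ hs0.le,
      Real.sqrt_sq hlam.le]
  rw [hden] at hb
  have hpos : 0 < Real.sqrt (-s) := Real.sqrt_pos.2 hs0
  rw [norm_smul, Real.norm_eq_abs, abs_of_pos hlam]
  calc lam * ‖u (T + lam ^ 2 * s) (lam • y)‖
      ≤ lam * (C / (lam * Real.sqrt (-s))) := mul_le_mul_of_nonneg_left hb hlam.le
    _ = C / Real.sqrt (-s) := by field_simp

/-- **The centred KNSS bound is closed under pointwise limits**: if every `wₙ` obeys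
`‖wₙ t x‖ ≤ C/(‖x‖ + √(−t))` for `t < 0` and `wₙ → v` pointwise on the open past, then
`HasTypeIDecay C v` — the spatial Type-I decay of an extracted tangent flow comes for free once the
forward datum of the extraction carries the centred bound. [folklore] -/
theorem hasTypeIDecay_of_tendsto
    {w : ℕ → ℝ → EuclideanSpace ℝ (Fin 3) → EuclideanSpace ℝ (Fin 3)}
    {v : ℝ → EuclideanSpace ℝ (Fin 3) → EuclideanSpace ℝ (Fin 3)} {C : ℝ}
    (hw : ∀ n, ∀ t < 0, ∀ x, ‖w n t x‖ ≤ C / (‖x‖ + Real.sqrt (-t)))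
    (hlim : ∀ t < 0, ∀ x, Tendsto (fun n => w n t x) atTop (𝓝 (v t x))) :
    HasTypeIDecay C v := fun t ht x =>
  le_of_tendsto (hlim t ht x).norm (Eventually.of_forall fun n => hw n t ht x)

end Summit.NavierStokesRegularity.RungBlowupCofinalLinearStrainParasitic
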